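/-
Copyright (c) 2026 the pub-hodgecm-mathlib formalisation cell (harness21).  Prover seat hodgecm-mathlib-K2E3-p17 (g6), Track B «K2-LIT» ∕ h413
(`stmt-HodgeConjecture-24833`), line `K2_E3_EllipticInputs`, unit U12 §L, Richardson road for (LBGL-ge3) at `N = 3` (road owner K2E3-p11),
brick (F-J) = (S-B♭)_Lie, FILE H2a «THE SPLIT ORBITAL MEASURE OF `𝔤𝔩₃(F)` IS `c′ · (√‖disc χ‖)⁻¹ · 1_{split rs} · μ𝔤` — GLOBALISATION».  2026-09-04.
-/
import Summits.HodgeConjecture.HodgeConjecture.Theorems.K2E3GL3OrbitalMeasureLocalDensity      -- ★ (this seat, H1c): the local density at every regular diagonal point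
import Summits.HodgeConjecture.HodgeConjecture.Theorems.K2E3GL3LieAdInvariant                   -- ★ p857802 (this seat, I): `Ad(G)`-invariance of `μ𝔤`
import Summits.HodgeConjecture.HodgeConjecture.Theorems.K2E3GL3KNOrbitalAdInvariant             -- ★ p857606 (K2E3-p03, D): `Ad(G)`-invariance of the `K × N₃` orbital integral
import Summits.HodgeConjecture.HodgeConjecture.Theorems.K2E3CubicRationalRootsLocallyConstant   -- ★ p857696∕p857706 (K2E3-p03, R′): (J0) diagonalisability, (J2) openness of the split rs set
import HarnessLib

/-!
# K2_E3 road (h413), §L ∕ Richardson road at `N = 3`, brick (F-J) FILE H2a: globalisation — for every Borel `g ≥ 0`,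
# `∫_{F³} ‖Δ(d)‖ ∫_{K×N₃} g(Ad(kn) diag d) d(κ⊗μN) d(dx^{⊗3}) = c′ · ∫_{𝔤′} g · (√‖disc χ‖)⁻¹ dμ𝔤`, `𝔤′ = {disc χ ≠ 0, χ has 3 rational roots}`

Cell `pub/hodgecm-mathlib` (D-0151), Track B, seat K2E3-p17 (g6), deal (D60) = (F-J) (road owner K2E3-p11).  `--supports stmt-HodgeConjecture-24833 --as helper`;
THEOREMS ONLY (no definition ∕ instance ∕ notation ∕ named fact ∕ `sorry`); never imports `Cruxes/…/Lines`.  COUNT-NEUTRAL.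

THE RESULT (**`exists_lintegral_delta_orbital_eq`**).  PROOF.  Both sides are measures in `g`: `ρ = (Φ₂)_*((‖Δ‖·dx^{⊗3}) ⊗ κ ⊗ μN)` with
`Φ₂(d,k,n) = Ad(kn) diag d`, and `λ = c′ · (√‖disc χ‖)⁻¹ · μ𝔤|_{𝔤′}`.  (i) Both vanish off `𝔤′` (`‖Δ(d)‖ = 0` unless `d` is injective, and then `Ad(q) diag d ∈ 𝔤′`).
(ii) Every `X ∈ 𝔤′` is `g · diag e · g⁻¹` with `e` injective (★ (J0)); by ★ H1c there is an open `V ∋ diag e` with `ρ(1_V h) = λ(1_V h)` for all `h`; the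
`Ad(g)`-translate `U = Ad(g) V ∋ X` satisfies `ρ|_U = λ|_U` because `ρ` is `Ad(G)`-invariant (★ D) and so is `λ` (★ I: `μ𝔤` is; `disc χ` is a class function).
(iii) `𝔤′` is second countable: countably many `U` cover it, and `Measure.restrict_biUnion_congr` glues.  The constant `c′` of ★ H1c does not depend on the
base point — that is what makes the gluing possible.
[HarishChandra1999AdmissibleDistributions, Thm. 7.7, Lemma 7.8, Lemma 7.9] [HarishChandra1970, Part V §4 Lemma 22] [WeilBNT1967, Ch. I §2]
HONEST LABEL: HC_CM is proved only modulo the 7 printed citations (2 remaining named inputs: hLiu418 = stmt-HodgeConjecture-24832, h413 = stmt-HodgeConjecture-24833)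
until rung 0 closes; count-neutral helper.

## References
* [HarishChandra1999AdmissibleDistributions] Harish-Chandra (DeBacker–Sally), *Admissible Invariant Distributions on Reductive p-adic Groups* (1999), §7.
* [HarishChandra1970] Harish-Chandra (van Dijk), *Harmonic Analysis on Reductive p-adic Groups*, LNM 162 (1970), Part V §4.
* [WeilBNT1967] A. Weil, *Basic Number Theory* (1967), Ch. I §2.
-/

set_option autoImplicit false
set_option linter.dupNamespace false

noncomputable section

open MeasureTheory Measure Filter Topology Set Matrix ValuativeRel
open scoped MatrixGroups NNReal ENNReal Valued
open Literature.NumberTheory.Automorphic Literature.NumberTheory.Automorphic.LocalFieldHaar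
open Literature.NumberTheory.GaloisRepresentations Literature.NumberTheory.GaloisRepresentations.IsNonarchimedeanLocalField
open Summit.HodgeConjecture.HodgeConjecture.Cruxes.H413.K2E3GL3OrbitChartDeriv
open Summit.HodgeConjecture.HodgeConjecture.Cruxes.H413.K2E3GL3SplitTorusWeylKit
open Summit.HodgeConjecture.HodgeConjecture.Cruxes.H413.K2E3GL3OrbitalMeasureLocalDensity
open Summit.HodgeConjecture.HodgeConjecture.Cruxes.H413.K2E3GL3LieAdInvariant
open Summit.HodgeConjecture.HodgeConjecture.Cruxes.H413.K2E3CubicRationalRootsLocallyConstant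

namespace Summit.HodgeConjecture.HodgeConjecture.Cruxes.H413.K2E3GL3SplitOrbitalMeasureDensity

variable {F : Type*} [Field F] [ValuativeRel F] [TopologicalSpace F] [IsNonarchimedeanLocalField F]
  [MeasurableSpace F] [BorelSpace F] [MeasurableSpace (GL (Fin 3) F)] [BorelSpace (GL (Fin 3) F)]
  [MeasurableSpace (Matrix (Fin 3) (Fin 3) F)] [BorelSpace (Matrix (Fin 3) (Fin 3) F)]

/-- **THE SPLIT ORBITAL MEASURE OF `𝔤𝔩₃(F)` HAS DENSITY `c′ · (√‖disc χ‖)⁻¹ · 1_{𝔤′}`** (see the module docstring).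
[cite: HarishChandra1999AdmissibleDistributions, Thm. 7.7, Lemma 7.8] [cite: HarishChandra1970, Part V §4 Lemma 22] [cite: WeilBNT1967, Ch. I §2] -/
theorem exists_lintegral_delta_orbital_eq (κ : Measure ↥(glInt 3 F)) [IsHaarMeasure κ]
    (μN : Measure ↥(unipotentRadicalGL F (id : Fin 3 → Fin 3))) [IsHaarMeasure μN]
    (μ𝔤 : Measure (Matrix (Fin 3) (Fin 3) F)) [μ𝔤.IsAddHaarMeasure] (dx : Measure F) [dx.IsAddHaarMeasure] :
    ∃ c' : ℝ≥0∞, c' ≠ 0 ∧ c' ≠ ⊤ ∧ ∀ g : Matrix (Fin 3) (Fin 3) F → ℝ≥0∞, Measurable g →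
      ∫⁻ d : Fin 3 → F, (normAbs F ((d 0 - d 1) * (d 0 - d 2) * (d 1 - d 2)) : ℝ≥0∞) *
          ∫⁻ q : ↥(glInt 3 F) × ↥(unipotentRadicalGL F (id : Fin 3 → Fin 3)),
            g ((((q.1 : GL (Fin 3) F) * (q.2 : GL (Fin 3) F) : GL (Fin 3) F) : Matrix (Fin 3) (Fin 3) F) * Matrix.diagonal d *
              ((((q.1 : GL (Fin 3) F) * (q.2 : GL (Fin 3) F))⁻¹ : GL (Fin 3) F) : Matrix (Fin 3) (Fin 3) F)) ∂(κ.prod μN)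
        ∂(Measure.pi fun _ : Fin 3 => dx) =
      c' * ∫⁻ Y in {Y : Matrix (Fin 3) (Fin 3) F | Y.charpoly.discr ≠ 0 ∧ Y.charpoly.roots.card = 3},
        g Y * (((NNReal.sqrt (normAbs F Y.charpoly.discr))⁻¹ : ℝ≥0) : ℝ≥0∞) ∂μ𝔤 := by
  classical
  haveI : T2Space F := (isLocalField F).toT2Space
  haveI : LocallyCompactSpace F := (isLocalField F).toLocallyCompactSpace
  haveI : SecondCountableTopology F := secondCountableTopology_localField F
  haveI : IsTopologicalRing F := inferInstance
  haveI : T2Space (GL (Fin 3) F) := t2Space_generalLinearGroup F 3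
  haveI : SecondCountableTopology (Matrix (Fin 3) (Fin 3) F) := inferInstanceAs (SecondCountableTopology (Fin 3 → Fin 3 → F))
  haveI : SecondCountableTopology (Matrix (Fin 3) (Fin 3) F)ᵐᵒᵖ := MulOpposite.opHomeomorph.symm.secondCountableTopology
  haveI : SecondCountableTopology (GL (Fin 3) F) := Units.isEmbedding_embedProduct.secondCountableTopology
  haveI : SecondCountableTopology ↥(glInt 3 F) := TopologicalSpace.Subtype.secondCountableTopology _
  haveI : SecondCountableTopology ↥(unipotentRadicalGL F (id : Fin 3 → Fin 3)) := TopologicalSpace.Subtype.secondCountableTopology _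
  haveI : BorelSpace ↥(glInt 3 F) := Subtype.borelSpace _
  haveI : BorelSpace ↥(unipotentRadicalGL F (id : Fin 3 → Fin 3)) := Subtype.borelSpace _
  haveI : BorelSpace (↥(glInt 3 F) × ↥(unipotentRadicalGL F (id : Fin 3 → Fin 3))) := Prod.borelSpace
  haveI : BorelSpace ((Fin 3 → F) × (↥(glInt 3 F) × ↥(unipotentRadicalGL F (id : Fin 3 → Fin 3)))) := Prod.borelSpace
  haveI : LocallyCompactSpace (GL (Fin 3) F) := locallyCompactSpace_generalLinearGroup F 3
  haveI : LocallyCompactSpace ↥(unipotentRadicalGL F (id : Fin 3 → Fin 3)) :=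
    (isClosed_unipotentRadicalGL (R := F) (id : Fin 3 → Fin 3)).locallyCompactSpace
  haveI : SFinite μN := inferInstance
  haveI : CompactSpace ↥(glInt 3 F) := isCompact_iff_compactSpace.1 (isCompact_glInt (n := 3) (F := F))
  haveI : IsFiniteMeasure κ := CompactSpace.isFiniteMeasure
  haveI : SFinite dx := inferInstance
  obtain ⟨c', hc'0, hc't, hloc⟩ := exists_local_density κ μN μ𝔤 dx
  refine ⟨c', hc'0, hc't, fun g hg => ?_⟩
  -- the regular split set, the weight
  set 𝔤' : Set (Matrix (Fin 3) (Fin 3) F) := {Y : Matrix (Fin 3) (Fin 3) F | Y.charpoly.discr ≠ 0 ∧ Y.charpoly.roots.card = 3} with h𝔤'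
  have h𝔤'o : IsOpen 𝔤' := isOpen_setOf_charpoly_discr_ne_zero_and_card_roots_eq 3
  have h𝔤'm : MeasurableSet 𝔤' := h𝔤'o.measurableSet
  have hdiscm : Measurable fun Y : Matrix (Fin 3) (Fin 3) F => Y.charpoly.discr := (F0P3cStCharTSHCDGroupToLie.continuous_discr_charpoly (K := F)).measurable
  set winv : Matrix (Fin 3) (Fin 3) F → ℝ≥0∞ := fun Y => (((NNReal.sqrt (normAbs F Y.charpoly.discr))⁻¹ : ℝ≥0) : ℝ≥0∞) with hwinv
  have hwinv_m : Measurable winv := ((NNReal.continuous_sqrt.measurable.comp (measurable_normAbs.comp hdiscm)).inv).coe_nnreal_ennreal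
  have hwinv_conj : ∀ (u : GL (Fin 3) F) (Y : Matrix (Fin 3) (Fin 3) F),
      winv ((u : Matrix (Fin 3) (Fin 3) F) * Y * ((u⁻¹ : GL (Fin 3) F) : Matrix (Fin 3) (Fin 3) F)) = winv Y := fun u Y => by
    simp only [hwinv, charpoly_conj_units]
  have h𝔤'_conj : ∀ (u : GL (Fin 3) F) {e : Fin 3 → F}, Function.Injective e →
      (u : Matrix (Fin 3) (Fin 3) F) * Matrix.diagonal e * ((u⁻¹ : GL (Fin 3) F) : Matrix (Fin 3) (Fin 3) F) ∈ 𝔤' := fun u e he =>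
    ⟨discr_charpoly_conj_diagonal_ne_zero u he, card_roots_charpoly_conj_diagonal u _⟩
  -- the two measures
  set Φ₂ : (Fin 3 → F) × (↥(glInt 3 F) × ↥(unipotentRadicalGL F (id : Fin 3 → Fin 3))) → Matrix (Fin 3) (Fin 3) F := fun p =>
    ((((p.2.1 : GL (Fin 3) F) * (p.2.2 : GL (Fin 3) F) : GL (Fin 3) F) : Matrix (Fin 3) (Fin 3) F) * Matrix.diagonal p.1 *
      ((((p.2.1 : GL (Fin 3) F) * (p.2.2 : GL (Fin 3) F))⁻¹ : GL (Fin 3) F) : Matrix (Fin 3) (Fin 3) F)) with hΦ₂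
  have hΦ₂c : Continuous Φ₂ := by
    have hq : Continuous fun p : (Fin 3 → F) × (↥(glInt 3 F) × ↥(unipotentRadicalGL F (id : Fin 3 → Fin 3))) =>
        ((p.2.1 : GL (Fin 3) F) * (p.2.2 : GL (Fin 3) F) : GL (Fin 3) F) :=
      (continuous_subtype_val.comp (continuous_fst.comp continuous_snd)).mul (continuous_subtype_val.comp (continuous_snd.comp continuous_snd))
    refine ((Units.continuous_val.comp hq).mul ?_).mul (Units.continuous_coe_inv.comp hq)
    exact continuous_matrix fun i j => by
      by_cases hij : i = j
      · subst hij; simp only [Matrix.diagonal_apply_eq]; exact (continuous_apply i).comp continuous_fst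
      · simp only [Matrix.diagonal_apply_ne _ hij]; exact continuous_const
  have hΦ₂m : Measurable Φ₂ := hΦ₂c.measurable
  set δ : (Fin 3 → F) → ℝ≥0∞ := fun d => (normAbs F ((d 0 - d 1) * (d 0 - d 2) * (d 1 - d 2)) : ℝ≥0∞) with hδ
  have hδm : Measurable δ := by
    refine (measurable_normAbs.comp ?_).coe_nnreal_ennreal
    exact (((continuous_apply 0).sub (continuous_apply 1)).mul ((continuous_apply 0).sub (continuous_apply 2))).mul
      ((continuous_apply 1).sub (continuous_apply 2)) |>.measurable
  set ρm : Measure (Matrix (Fin 3) (Fin 3) F) := Measure.map Φ₂ (((Measure.pi fun _ : Fin 3 => dx).withDensity δ).prod (κ.prod μN)) with hρm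
  set lam : Measure (Matrix (Fin 3) (Fin 3) F) := c' • (μ𝔤.restrict 𝔤').withDensity winv with hlam_def
  have hρ : ∀ G : Matrix (Fin 3) (Fin 3) F → ℝ≥0∞, Measurable G → ∫⁻ Y, G Y ∂ρm =
      ∫⁻ d : Fin 3 → F, δ d * ∫⁻ q : ↥(glInt 3 F) × ↥(unipotentRadicalGL F (id : Fin 3 → Fin 3)), G (Φ₂ (d, q)) ∂(κ.prod μN)
        ∂(Measure.pi fun _ : Fin 3 => dx) := by
    intro G hG
    have hinner : Measurable fun d : Fin 3 → F =>
        ∫⁻ q : ↥(glInt 3 F) × ↥(unipotentRadicalGL F (id : Fin 3 → Fin 3)), G (Φ₂ (d, q)) ∂(κ.prod μN) :=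
      (hG.comp hΦ₂m).lintegral_prod_right'
    rw [hρm, lintegral_map hG hΦ₂m, lintegral_prod (fun z => G (Φ₂ z)) (hG.comp hΦ₂m).aemeasurable,
      lintegral_withDensity_eq_lintegral_mul _ hδm hinner]
    rfl
  have hlam : ∀ G : Matrix (Fin 3) (Fin 3) F → ℝ≥0∞, Measurable G → ∫⁻ Y, G Y ∂lam = c' * ∫⁻ Y in 𝔤', G Y * winv Y ∂μ𝔤 := by
    intro G hG
    rw [hlam_def, lintegral_smul_measure, lintegral_withDensity_eq_lintegral_mul _ hwinv_m hG, smul_eq_mul]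
    congr 1
    exact lintegral_congr fun Y => mul_comm _ _
  suffices hρlam : ρm = lam by
    have h1 := hρ g hg
    rw [hρlam, hlam g hg] at h1
    exact h1.symm
  -- (i) both measures live on `𝔤'`
  have hρ𝔤' : ρm 𝔤'ᶜ = 0 := by
    rw [← lintegral_indicator_one h𝔤'm.compl, hρ _ (measurable_one.indicator h𝔤'm.compl)]
    refine (lintegral_congr fun d => ?_).trans lintegral_zero
    by_cases hΔ : (d 0 - d 1) * (d 0 - d 2) * (d 1 - d 2) = 0
    · simp only [hδ, hΔ, map_zero, ENNReal.coe_zero, zero_mul]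
    · have hd := injective_of_delta_ne_zero hΔ
      have : ∀ q : ↥(glInt 3 F) × ↥(unipotentRadicalGL F (id : Fin 3 → Fin 3)), (𝔤'ᶜ).indicator (1 : Matrix (Fin 3) (Fin 3) F → ℝ≥0∞) (Φ₂ (d, q)) = 0 :=
        fun q => Set.indicator_of_notMem (Set.notMem_compl_iff.2 (h𝔤'_conj _ hd)) _
      simp only [this, lintegral_zero, mul_zero]
  have hlam𝔤' : lam 𝔤'ᶜ = 0 := by
    rw [hlam_def, Measure.smul_apply, withDensity_apply _ h𝔤'm.compl, Measure.restrict_restrict h𝔤'm.compl, Set.compl_inter_self,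
      Measure.restrict_empty, lintegral_zero_measure, smul_zero]
  -- (ii) local agreement near every point of `𝔤'`
  have hlocal : ∀ X ∈ 𝔤', ∃ U : Set (Matrix (Fin 3) (Fin 3) F), IsOpen U ∧ X ∈ U ∧ U ⊆ 𝔤' ∧ ρm.restrict U = lam.restrict U := by
    rintro X ⟨hD, h3⟩
    obtain ⟨g₀, e, he, rfl⟩ := exists_conj_diagonal_of_card_roots_eq_three X h3 hD
    obtain ⟨V, hVo, heV, hVel, hVid⟩ := hloc e he
    have hV_m : MeasurableSet V := hVo.measurableSet
    set U : Set (Matrix (Fin 3) (Fin 3) F) :=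
      (fun Y => ((g₀⁻¹ : GL (Fin 3) F) : Matrix (Fin 3) (Fin 3) F) * Y * (g₀ : Matrix (Fin 3) (Fin 3) F)) ⁻¹' V with hU
    have hcU : Continuous fun Y : Matrix (Fin 3) (Fin 3) F => ((g₀⁻¹ : GL (Fin 3) F) : Matrix (Fin 3) (Fin 3) F) * Y * (g₀ : Matrix (Fin 3) (Fin 3) F) :=
      (continuous_const.mul continuous_id).mul continuous_const
    have hUo : IsOpen U := hVo.preimage hcU
    have hU_m : MeasurableSet U := hUo.measurableSet
    -- `Ad(g₀⁻¹) Ad(g₀) = id` and friends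
    have hcancel : ∀ Y : Matrix (Fin 3) (Fin 3) F, ((g₀⁻¹ : GL (Fin 3) F) : Matrix (Fin 3) (Fin 3) F) *
        ((g₀ : Matrix (Fin 3) (Fin 3) F) * Y * ((g₀⁻¹ : GL (Fin 3) F) : Matrix (Fin 3) (Fin 3) F)) * (g₀ : Matrix (Fin 3) (Fin 3) F) = Y := fun Y => by
      rw [show ((g₀⁻¹ : GL (Fin 3) F) : Matrix (Fin 3) (Fin 3) F) * ((g₀ : Matrix (Fin 3) (Fin 3) F) * Y * ((g₀⁻¹ : GL (Fin 3) F) : Matrix (Fin 3) (Fin 3) F)) *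
          (g₀ : Matrix (Fin 3) (Fin 3) F) = (((g₀⁻¹ : GL (Fin 3) F) : Matrix (Fin 3) (Fin 3) F) * (g₀ : Matrix (Fin 3) (Fin 3) F)) * Y *
          (((g₀⁻¹ : GL (Fin 3) F) : Matrix (Fin 3) (Fin 3) F) * (g₀ : Matrix (Fin 3) (Fin 3) F)) by simp only [Matrix.mul_assoc],
        Units.inv_mul, Matrix.one_mul, Matrix.mul_one]
    have hcancel' : ∀ Y : Matrix (Fin 3) (Fin 3) F, (g₀ : Matrix (Fin 3) (Fin 3) F) *
        (((g₀⁻¹ : GL (Fin 3) F) : Matrix (Fin 3) (Fin 3) F) * Y * (g₀ : Matrix (Fin 3) (Fin 3) F)) * ((g₀⁻¹ : GL (Fin 3) F) : Matrix (Fin 3) (Fin 3) F) = Y :=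
      fun Y => by
      rw [show (g₀ : Matrix (Fin 3) (Fin 3) F) * (((g₀⁻¹ : GL (Fin 3) F) : Matrix (Fin 3) (Fin 3) F) * Y * (g₀ : Matrix (Fin 3) (Fin 3) F)) *
          ((g₀⁻¹ : GL (Fin 3) F) : Matrix (Fin 3) (Fin 3) F) = ((g₀ : Matrix (Fin 3) (Fin 3) F) * ((g₀⁻¹ : GL (Fin 3) F) : Matrix (Fin 3) (Fin 3) F)) * Y *
          ((g₀ : Matrix (Fin 3) (Fin 3) F) * ((g₀⁻¹ : GL (Fin 3) F) : Matrix (Fin 3) (Fin 3) F)) by simp only [Matrix.mul_assoc],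
        Units.mul_inv, Matrix.one_mul, Matrix.mul_one]
    have hmemU : ∀ Y : Matrix (Fin 3) (Fin 3) F, Y ∈ U ↔
        ((g₀⁻¹ : GL (Fin 3) F) : Matrix (Fin 3) (Fin 3) F) * Y * (g₀ : Matrix (Fin 3) (Fin 3) F) ∈ V := fun Y => Iff.rfl
    have hXU : (g₀ : Matrix (Fin 3) (Fin 3) F) * Matrix.diagonal e * ((g₀⁻¹ : GL (Fin 3) F) : Matrix (Fin 3) (Fin 3) F) ∈ U := by
      rw [hmemU, hcancel]; exact heV
    have hUsub : U ⊆ 𝔤' := by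
      intro Y hY
      obtain ⟨g₁, e₁, he₁, hge⟩ := hVel _ ((hmemU Y).1 hY)
      have : Y = ((g₀ * g₁ : GL (Fin 3) F) : Matrix (Fin 3) (Fin 3) F) * Matrix.diagonal e₁ * (((g₀ * g₁)⁻¹ : GL (Fin 3) F) : Matrix (Fin 3) (Fin 3) F) := by
        rw [← hcancel' Y, hge, _root_.mul_inv_rev g₀ g₁, Units.val_mul g₀ g₁, Units.val_mul g₁⁻¹ g₀⁻¹]; simp only [Matrix.mul_assoc]
      rw [this]; exact h𝔤'_conj _ he₁
    refine ⟨U, hUo, hXU, hUsub, Measure.ext fun s hs => ?_⟩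
    rw [Measure.restrict_apply hs, Measure.restrict_apply hs]
    -- the test function `h(Z) = 1_s(g₀ Z g₀⁻¹)`
    set hfun : Matrix (Fin 3) (Fin 3) F → ℝ≥0∞ := fun Z =>
      s.indicator 1 ((g₀ : Matrix (Fin 3) (Fin 3) F) * Z * ((g₀⁻¹ : GL (Fin 3) F) : Matrix (Fin 3) (Fin 3) F)) with hhfun
    have hhfun_m : Measurable hfun := (measurable_one.indicator hs).comp ((continuous_const.mul continuous_id).mul continuous_const).measurable
    have hind : ∀ Y : Matrix (Fin 3) (Fin 3) F, (s ∩ U).indicator (1 : Matrix (Fin 3) (Fin 3) F → ℝ≥0∞) Y =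
        V.indicator hfun (((g₀⁻¹ : GL (Fin 3) F) : Matrix (Fin 3) (Fin 3) F) * Y * (g₀ : Matrix (Fin 3) (Fin 3) F)) := by
      intro Y
      by_cases hYU : Y ∈ U
      · rw [Set.indicator_of_mem ((hmemU Y).1 hYU)]
        simp only [hhfun, hcancel']
        by_cases hYs : Y ∈ s
        · rw [Set.indicator_of_mem (Set.mem_inter hYs hYU), Set.indicator_of_mem hYs]
        · rw [Set.indicator_of_notMem (fun h => hYs h.1), Set.indicator_of_notMem hYs]
      · rw [Set.indicator_of_notMem (fun h => hYU h.2), Set.indicator_of_notMem (fun h => hYU ((hmemU Y).2 h))]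
    -- `ρm (s ∩ U) = c' ∫_V hfun · winv`
    have hρU : ρm (s ∩ U) = c' * ∫⁻ Y in V, hfun Y * winv Y ∂μ𝔤 := by
      rw [← lintegral_indicator_one (hs.inter hU_m), hρ _ (measurable_one.indicator (hs.inter hU_m)), ← hVid hfun hhfun_m]
      refine lintegral_congr fun d => ?_
      congr 1
      simp only [hΦ₂, hind]
      -- `Ad(g₀⁻¹)` inside the orbital integral (★ D)
      have hD := K2E3GL3KNOrbitalAdInvariant.GL3.lintegral_prod_conj_diagonal_eq κ μN d g₀⁻¹ (V.indicator hfun) (hhfun_m.indicator hV_m)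
      refine Eq.trans (lintegral_congr fun q => ?_) hD
      rw [_root_.mul_inv_rev g₀⁻¹ ((q.1 : GL (Fin 3) F) * (q.2 : GL (Fin 3) F)), inv_inv,
        Units.val_mul g₀⁻¹ ((q.1 : GL (Fin 3) F) * (q.2 : GL (Fin 3) F)), Units.val_mul (((q.1 : GL (Fin 3) F) * (q.2 : GL (Fin 3) F))⁻¹) g₀]
      simp only [Matrix.mul_assoc]
    -- `lam (s ∩ U) = c' ∫_V hfun · winv`
    have hlamU : lam (s ∩ U) = c' * ∫⁻ Y in V, hfun Y * winv Y ∂μ𝔤 := by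
      rw [hlam_def, Measure.smul_apply, withDensity_apply _ (hs.inter hU_m), Measure.restrict_restrict (hs.inter hU_m),
        Set.inter_eq_left.2 ((Set.inter_subset_right).trans hUsub), smul_eq_mul]
      congr 1
      rw [← lintegral_indicator (hs.inter hU_m), ← lintegral_indicator hV_m, ← lintegral_comp_conj_eq μ𝔤 g₀ ((s ∩ U).indicator winv)]
      refine lintegral_congr fun Y => ?_
      by_cases hYV : Y ∈ V
      · rw [Set.indicator_of_mem hYV]
        have hYU : (g₀ : Matrix (Fin 3) (Fin 3) F) * Y * ((g₀⁻¹ : GL (Fin 3) F) : Matrix (Fin 3) (Fin 3) F) ∈ U := by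
          rw [hmemU, hcancel]; exact hYV
        simp only [hhfun]
        by_cases hYs : (g₀ : Matrix (Fin 3) (Fin 3) F) * Y * ((g₀⁻¹ : GL (Fin 3) F) : Matrix (Fin 3) (Fin 3) F) ∈ s
        · rw [Set.indicator_of_mem (Set.mem_inter hYs hYU), Set.indicator_of_mem hYs, hwinv_conj, Pi.one_apply, one_mul]
        · rw [Set.indicator_of_notMem (fun h => hYs h.1), Set.indicator_of_notMem hYs, zero_mul]
      · rw [Set.indicator_of_notMem hYV, Set.indicator_of_notMem]
        exact fun h => hYV (by have := (hmemU _).1 h.2; rwa [hcancel] at this)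
    rw [hρU, hlamU]
  -- (iii) glue
  choose U hUo hXU hUsub hUeq using hlocal
  obtain ⟨T, hTc, hTU⟩ := TopologicalSpace.isOpen_iUnion_countable (fun X : ↥𝔤' => U X.1 X.2) fun X => hUo X.1 X.2
  set G : Set (Matrix (Fin 3) (Fin 3) F) := ⋃ X ∈ T, U X.1 X.2 with hG
  have hGeq : ρm.restrict G = lam.restrict G := (Measure.restrict_biUnion_congr hTc).2 fun X _ => hUeq X.1 X.2
  have h𝔤'G : 𝔤' ⊆ G := by
    intro X hX
    have h1 : X ∈ ⋃ Y : ↥𝔤', U Y.1 Y.2 := Set.mem_iUnion.2 ⟨⟨X, hX⟩, hXU X hX⟩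
    rw [← hTU] at h1
    exact h1
  have hρG : ∀ᵐ x ∂ρm, x ∈ G :=
    ae_iff.2 (measure_mono_null (fun x hx hx' => hx (h𝔤'G hx')) hρ𝔤')
  have hlamG : ∀ᵐ x ∂lam, x ∈ G :=
    ae_iff.2 (measure_mono_null (fun x hx hx' => hx (h𝔤'G hx')) hlam𝔤')
  rw [← Measure.restrict_eq_self_of_ae_mem hρG, ← Measure.restrict_eq_self_of_ae_mem hlamG, hGeq]

end Summit.HodgeConjecture.HodgeConjecture.Cruxes.H413.K2E3GL3SplitOrbitalMeasureDensity

end
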